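import Summits.ResolutionOfSingularities.ResolutionOfSingularities.Theorems.UniversalCellsCampaignW82SmoothTwistLinks
import Summits.ResolutionOfSingularities.ResolutionOfSingularities.Theorems.UniversalCellsCampaignW82FrobeniusTwistRungs
import HarnessLib

/-!
# [OURS · L1 W8.2] Both door cruxes hang on the FROBENIUS-TWIST step BY NAME; the summit implies it — links

Cell `res-hironaka`, LADDER-RESOLUTION rung L (RESCUE), slot W8.2; prover res-L1-s82-pv-1 (gen 2). Leaf file in
the existing Theses-importing cone of Theorems/UniversalCellsCampaignW82SmoothTwistLinks.lean (doors 1 and 2);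
pure logic on top of the Theses-free equivalence `CampaignW82.perfectionStepAt_iff_frobeniusTwistStepAt`
(Theorems/UniversalCellsCampaignW82FrobeniusTwistProofs.lean, p483734).

WHAT IS PROVED (no new mathematics; by-name rewiring to the single-field normal form):
* `primeFieldToPerfect_of_forall_frobeniusTwistStepDimLe_top` — the crux `UniversalCells.PrimeFieldToPerfect`
  (stmt-ResolutionOfSingularities-15233) follows from `FrobeniusTwistStepDimLe p ⊤` at every prime `p`: «for
  every perfect `M` of characteristic `p` with resolution over `M(t)`, every irreducible geometrically reduced
  variety over `M(t)` has a Frobenius twist with a SMOOTH proper birational model over `M(t)`».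
* `primeModelTransfer_of_forall_frobeniusTwistStepDimLe_top`,
  `primeModelTransfer_of_forall_frobeniusTwistStepAt_algClosureFg_top` — the crux
  `UniformComplexity.PrimeModelTransfer` (stmt-ResolutionOfSingularities-8933) from the same, resp. from the
  Frobenius-twist step at the countably many constant fields `M = (𝔽_p(s))^{alg} ∩ K`.
* `frobeniusTwistStepAt_of_resolutionInChar`, `frobeniusTwistStepDimLe_of_resolutionInChar` — conversely every
  instance follows from the summit statement `ResolutionInChar p` (never trivially false, kernel-checked).

HONEST FRAMING. OURS work of the rescue rung; NOT a statement of the manuscript (role replaced: [Hironaka2017]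
§17 ¶2 / §2 p.4, see the statement file p483512); no external premise; AI work, weaker than expert review.
-/

noncomputable section

set_option linter.dupNamespace false -- mandated namespace of this single-conjunct summit

open _root_.CategoryTheory _root_.CategoryTheory.Limits _root_.AlgebraicGeometry
open Literature.AlgebraicGeometry.Resolution

namespace Summit.ResolutionOfSingularities.ResolutionOfSingularities.Theorems.CampaignW82

/-- **Door 1 hangs on the Frobenius-twist step**: `UniversalCells.PrimeFieldToPerfect`
(stmt-ResolutionOfSingularities-15233) follows from `FrobeniusTwistStepDimLe p ⊤` at every prime `p`.
[folklore] -/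
theorem primeFieldToPerfect_of_forall_frobeniusTwistStepDimLe_top
    (h : ∀ (p : ℕ) [Fact p.Prime], FrobeniusTwistStepDimLe p ⊤) :
    Summit.ResolutionOfSingularities.ResolutionOfSingularities.Theses.UniversalCells.PrimeFieldToPerfect :=
  primeFieldToPerfect_of_forall_perfectionStepDimLe_top fun p hp =>
    haveI : Fact p.Prime := ⟨hp⟩
    (perfectionStepDimLe_iff_frobeniusTwistStepDimLe p ⊤).2 (h p)

/-- **Door 2 hangs on the Frobenius-twist step (perfect constant fields)**:
`UniformComplexity.PrimeModelTransfer` (stmt-ResolutionOfSingularities-8933) follows from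
`FrobeniusTwistStepDimLe p ⊤` at every prime `p`. [folklore] -/
theorem primeModelTransfer_of_forall_frobeniusTwistStepDimLe_top
    (h : ∀ (p : ℕ) [Fact p.Prime], FrobeniusTwistStepDimLe p ⊤) :
    Summit.ResolutionOfSingularities.ResolutionOfSingularities.Theses.UniformComplexity.PrimeModelTransfer :=
  primeModelTransfer_of_forall_perfectionStepDimLe_top fun p hp =>
    haveI : Fact p.Prime := ⟨hp⟩
    (perfectionStepDimLe_iff_frobeniusTwistStepDimLe p ⊤).2 (h p)

/-- **Door 2, sharpest form**: `UniformComplexity.PrimeModelTransfer` follows from the Frobenius-twist step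
at `⊤` at the countably many constant fields `M = (𝔽_p(s))^{alg} ∩ K` (`K` algebraically closed of
characteristic `p`, `s ⊆ K` finite). [folklore] -/
theorem primeModelTransfer_of_forall_frobeniusTwistStepAt_algClosureFg_top
    (h : ∀ (p : ℕ) [Fact p.Prime] (K : Type) [Field K] [CharP K p] [IsAlgClosed K] (s : Finset K),
      FrobeniusTwistStepAt p (algebraicClosure (Subfield.closure (↑s : Set K)) K) ⊤) :
    Summit.ResolutionOfSingularities.ResolutionOfSingularities.Theses.UniformComplexity.PrimeModelTransfer :=
  primeModelTransfer_of_forall_perfectionStepAlgClosureFgDimLe_top fun p hp =>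
    haveI : Fact p.Prime := ⟨hp⟩
    (perfectionStepAlgClosureFgDimLe_iff_forall_frobeniusTwistStepAt p ⊤).2 (h p)

/-- **Every instance of the Frobenius-twist step follows from the summit** (through the perfection step):
if `ResolutionInChar p` holds then over `RatFunc M` (`M` of characteristic `p`) every irreducible
geometrically reduced variety has a Frobenius twist with a smooth proper birational model. [folklore] -/
theorem frobeniusTwistStepAt_of_resolutionInChar {p : ℕ} [Fact p.Prime] (h : ResolutionInChar.{0} p)
    (M : Type) [Field M] [CharP M p] (n : WithBot ℕ∞) : FrobeniusTwistStepAt p M n :=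
  (perfectionStepAt_iff_frobeniusTwistStepAt p M n).1 (perfectionStepAt_of_resolutionInChar h M n)

/-- Hence the door-1 graded Frobenius-twist step at every grade from the summit. [folklore] -/
theorem frobeniusTwistStepDimLe_of_resolutionInChar {p : ℕ} [Fact p.Prime] (h : ResolutionInChar.{0} p)
    (n : WithBot ℕ∞) : FrobeniusTwistStepDimLe p n :=
  fun M _ _ _ => frobeniusTwistStepAt_of_resolutionInChar h M n

end Summit.ResolutionOfSingularities.ResolutionOfSingularities.Theorems.CampaignW82

end
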